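import Literature.Analysis.FluidPDE.PotentialFlowParabolicExterior
import HarnessLib

/-!
# The dipole-moment flow `u = c(−t)∇(∂ₑΓ)(x)` on the parabolic exterior: a Type-I classical Navier–Stokes
# flow with `O(|x|⁻³)` spatial decay and vanishing final-time trace

Analysis/FluidPDE proofs-layer file (theorems + data definitions, no new `Prop` facts), companion of
`PotentialFlowParabolicExterior.lean` (`l = 0`: `√(−t)∇Γ`), for the `l = 1` exterior mode: with the
dipole-moment potential `Φₑ = ∂ₑΓ = ⟪x,e⟫/(4π|x|³)` (harmonic off the origin) and `Fₑ = ∇Φₑ`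
(`|Fₑ| ≤ ‖e‖/(π|x|³)`, tree `abs_fderiv_fderiv_newtonKernel_apply_le`), the flow `u = c(−t) Fₑ(x)`,
`p = cΦₑ − c²t²|Fₑ|²/2` is, in similarity variables, the STATIONARY profile `W(y) = cFₑ(y) = O(|y|⁻³)`,
`∇W = O(|y|⁻⁴)` on `{|y| > R} × ℝ_s`:

* `dipoleMoment e`, `quadField e`, `quadFlow c e`, `quadPressure c e` — the data;
* `quadField_identities` — `div Fₑ = 0`, `ΔFₑ = 0`, `(Fₑ·∇)Fₑ = ∇(½|Fₑ|²)` off the origin (through the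
  smooth cut-off potential `∂ₑΓ∞`, `fderiv_laplacian_apply`, `laplacian_gradient_eq_zero`,
  `convect_gradient_self`);
* `quadFlow_isClassical`, `quadFlow_isSuitable` — classical, hence suitable weak, Navier–Stokes solution on
  the parabolic exterior `Ω_R` (`R ≥ 0`);
* `quadFlow_typeI` — the space–time Type-I bound with constant `|c|` on `Ω_R`, `R ≥ 1`;
* `tendsto_eLpNorm_quadFlow` — vanishing final-time trace off the origin (`‖u‖ ≤ |c|δ‖e‖/(πρ³)`);
* `exists_sameScar_typeI_cubicDecay_not_aeEq_parabolicExterior` — **backward NON-uniqueness from the scar on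
  `Ω_R` inside the decay class `‖u(t,x)‖ ≤ C(−t)/(π|x|³)` (similarity `|W| ≤ C/(π|y|³)`), for every
  `R ≥ 1`, `C > 0`.**

Written by the disprover of route item `ScarRigidity` (stmt-NavierStokesRegularity-11717, route RellichScar):
the decay class is exactly what the route's foreseen `DifferenceDecay` step would deliver, so no decay-rate
hypothesis repairs an exterior Rellich lemma. On paper the same holds for every `2^l`-pole `∇(r^{−l−1}Y_lm)`
with amplitude `(−t)^{(l+1)/2}`.

## References

* J. Serrin, Arch. Rational Mech. Anal. 9 (1962) 187–195 (potential flows `a(t)∇h`). [Serrin1962]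
* D. Gilbarg, N. Trudinger, *Elliptic PDE of Second Order*, (2.13) (`DᵢⱼΓ`). [GilbargTrudinger2001]
-/

noncomputable section

open Set Filter Function MeasureTheory Metric TopologicalSpace
open scoped Topology ENNReal NNReal InnerProductSpace RealInnerProductSpace Laplacian

namespace Literature.Analysis.FluidPDE

/-- Local notation for physical space `ℝ³ = EuclideanSpace ℝ (Fin 3)`. -/
local notation "ℝ³" => EuclideanSpace ℝ (Fin 3)

/-! ## A measure-theoretic criterion -/

/-- A.E.-DISTINCTNESS CRITERION: two functions differing at every point of a non-empty open subset of `S`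
are not a.e. equal on `S`. [folklore] -/
private theorem not_aeEq_restrict_of_ne_on_open {f g : ℝ × ℝ³ → ℝ³} {S U : Set (ℝ × ℝ³)} (hU : IsOpen U)
    (hUne : U.Nonempty) (hUS : U ⊆ S) (hne : ∀ z ∈ U, f z ≠ g z) :
    ¬ (f =ᵐ[volume.restrict S] g) := by
  intro h
  have hUpos : 0 < volume.restrict S U := by
    rw [Measure.restrict_apply hU.measurableSet, inter_eq_left.2 hUS]
    exact hU.measure_pos volume hUne
  have hnull : volume.restrict S U = 0 :=
    measure_mono_null (fun z hz => by simpa using hne z hz) (ae_iff.1 h)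
  exact hUpos.ne' hnull


/-! ## The dipole-moment potential, its gradient field and the `l = 1` flow -/

/-- The dipole-moment potential `Φₑ(x) = ∂ₑΓ(x) = ⟪x, e⟫/(4π|x|³)` (harmonic off the origin). [folklore] -/
def dipoleMoment (e : ℝ³) : ℝ³ → ℝ := fun x => fderiv ℝ newtonKernel x e

/-- Its gradient field `Fₑ = ∇Φₑ = (e|x|² − 3⟪x,e⟫x)/(4π|x|⁵)`, `|Fₑ| = O(|x|⁻³)`. [folklore] -/
def quadField (e : ℝ³) : ℝ³ → ℝ³ := gradient (dipoleMoment e)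

/-- `Φₑ` is smooth off the origin. [folklore] -/
theorem contDiffAt_dipoleMoment (e : ℝ³) {x : ℝ³} (hx : x ≠ 0) {n : WithTop ℕ∞} :
    ContDiffAt ℝ n (dipoleMoment e) x := by
  have h : ContDiffAt ℝ n (fderiv ℝ newtonKernel) x :=
    (contDiffOn_fderiv_newtonKernel (n := n)).contDiffAt (isOpen_compl_singleton.mem_nhds hx)
  exact h.clm_apply contDiffAt_const

/-- `Fₑ` is smooth off the origin. [folklore] -/
theorem contDiffAt_quadField (e : ℝ³) {x : ℝ³} (hx : x ≠ 0) {n : WithTop ℕ∞} :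
    ContDiffAt ℝ n (quadField e) x := by
  have h : ContDiffAt ℝ (n + 1) (dipoleMoment e) x := contDiffAt_dipoleMoment e hx
  have h' : ContDiffAt ℝ n (fderiv ℝ (dipoleMoment e)) x := h.fderiv_right le_rfl
  exact (InnerProductSpace.toDual ℝ ℝ³).symm.contDiff.contDiffAt.comp x h'

/-- The local smooth potential: `Φₑ = ∂ₑΓ∞` near every `x` with `ρ < ‖x‖`. [folklore] -/
theorem dipoleMoment_eventuallyEq {ρ : ℝ} (hρ : 0 < ρ) (e : ℝ³) {x : ℝ³} (hx : ρ < ‖x‖) :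
    dipoleMoment e =ᶠ[𝓝 x] fun y => fderiv ℝ (newtonFar (ρ / 2) ρ) y e := by
  have hopen : IsOpen {y : ℝ³ | ρ < ‖y‖} := isOpen_lt continuous_const continuous_norm
  filter_upwards [hopen.mem_nhds hx] with y hy
  have hloc := newtonFar_eventuallyEq_newtonKernel (by linarith : 0 ≤ ρ / 2) (by linarith) hy
  show fderiv ℝ newtonKernel y e = fderiv ℝ (newtonFar (ρ / 2) ρ) y e
  rw [hloc.fderiv_eq]

/-- `Fₑ = ∇(∂ₑΓ∞)` near every `x` with `ρ < ‖x‖`. [folklore] -/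
theorem quadField_eventuallyEq {ρ : ℝ} (hρ : 0 < ρ) (e : ℝ³) {x : ℝ³} (hx : ρ < ‖x‖) :
    quadField e =ᶠ[𝓝 x] gradient (fun y => fderiv ℝ (newtonFar (ρ / 2) ρ) y e) := by
  have hopen : IsOpen {y : ℝ³ | ρ < ‖y‖} := isOpen_lt continuous_const continuous_norm
  filter_upwards [hopen.mem_nhds hx] with y hy
  show (InnerProductSpace.toDual ℝ ℝ³).symm (fderiv ℝ (dipoleMoment e) y) =
    (InnerProductSpace.toDual ℝ ℝ³).symm (fderiv ℝ (fun w => fderiv ℝ (newtonFar (ρ / 2) ρ) w e) y)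
  rw [(dipoleMoment_eventuallyEq hρ e hy).fderiv_eq]

/-- `∂ₑΓ∞` is `Cⁿ`. [folklore] -/
theorem contDiff_fderiv_newtonFar_apply {ρ : ℝ} (hρ : 0 < ρ) (e : ℝ³) (n : ℕ) :
    ContDiff ℝ n (fun y => fderiv ℝ (newtonFar (ρ / 2) ρ) y e) := by
  have h : ContDiff ℝ (n + 1) (newtonFar (ρ / 2) ρ) := by
    have := contDiff_newtonFar' hρ (n + 1)
    exact_mod_cast this
  exact (h.fderiv_right le_rfl).clm_apply contDiff_const

/-- `Δ(∂ₑΓ∞) = 0` near every `x` with `ρ < ‖x‖` (`Δ∂ₑ = ∂ₑΔ` and `ΔΓ∞ = 0` there). [folklore] -/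
theorem laplacian_fderiv_newtonFar_eventuallyEq_zero {ρ : ℝ} (hρ : 0 < ρ) (e : ℝ³) {x : ℝ³}
    (hx : ρ < ‖x‖) : Δ (fun y => fderiv ℝ (newtonFar (ρ / 2) ρ) y e) =ᶠ[𝓝 x] fun _ => (0 : ℝ) := by
  have hopen : IsOpen {y : ℝ³ | ρ < ‖y‖} := isOpen_lt continuous_const continuous_norm
  have h3 : ContDiff ℝ 3 (newtonFar (ρ / 2) ρ) := contDiff_newtonFar' hρ 3
  filter_upwards [hopen.mem_nhds hx] with y hy
  rw [← fderiv_laplacian_apply h3 y e, (laplacian_newtonFar_eventuallyEq_zero hρ hy).fderiv_eq,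
    fderiv_fun_const]
  rfl

/-- **The dipole-moment field is an exact steady potential flow off the origin**: `div Fₑ = 0`,
`ΔFₑ = 0`, `(Fₑ·∇)Fₑ = ∇(½|Fₑ|²)` at every `x ≠ 0`. [folklore] -/
theorem quadField_identities (e : ℝ³) {x : ℝ³} (hx : x ≠ 0) :
    VectorCalculus.divergence (quadField e) x = 0 ∧ Δ (quadField e) x = 0 ∧
      convect (quadField e) (quadField e) x = gradient (fun y => 2⁻¹ * ‖quadField e y‖ ^ 2) x := by
  set ρ := ‖x‖ / 2 with hρdef
  have hρ : 0 < ρ := by have := norm_pos_iff.2 hx; positivity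
  have hxρ : ρ < ‖x‖ := by have := norm_pos_iff.2 hx; rw [hρdef]; linarith
  set Θ : ℝ³ → ℝ := fun y => fderiv ℝ (newtonFar (ρ / 2) ρ) y e with hΘ
  have hloc := quadField_eventuallyEq hρ e hxρ
  have h2 : ContDiff ℝ 2 Θ := contDiff_fderiv_newtonFar_apply hρ e 2
  have h3 : ContDiff ℝ 3 Θ := contDiff_fderiv_newtonFar_apply hρ e 3
  have hΔ := laplacian_fderiv_newtonFar_eventuallyEq_zero hρ e hxρ
  refine ⟨?_, ?_, ?_⟩
  · rw [VectorCalculus.divergence, hloc.fderiv_eq, ← VectorCalculus.divergence, divergence_gradient h2 x,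
      hΔ.eq_of_nhds]
  · rw [(InnerProductSpace.laplacian_congr_nhds hloc).eq_of_nhds]
    exact laplacian_gradient_eq_zero h3 hΔ
  · have hsq : (fun y => 2⁻¹ * ‖quadField e y‖ ^ 2) =ᶠ[𝓝 x] fun y => 2⁻¹ * ‖gradient Θ y‖ ^ 2 := by
      filter_upwards [hloc] with y hy
      rw [hy]
    rw [convect, hloc.fderiv_eq, hloc.eq_of_nhds, ← convect, convect_gradient_self h2 x]
    show _ = (InnerProductSpace.toDual ℝ ℝ³).symm (fderiv ℝ (fun y => 2⁻¹ * ‖quadField e y‖ ^ 2) x)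
    rw [hsq.fderiv_eq]
    rfl

/-- `|Fₑ(x)| ≤ ‖e‖/(π|x|³)` off the origin (from `|D²Γ(x)(a,b)| ≤ |a||b|/(π|x|³)`). [folklore] -/
theorem norm_quadField_le (e : ℝ³) {x : ℝ³} (hx : x ≠ 0) : ‖quadField e x‖ ≤ ‖e‖ / (Real.pi * ‖x‖ ^ 3) := by
  show ‖(InnerProductSpace.toDual ℝ ℝ³).symm (fderiv ℝ (dipoleMoment e) x)‖ ≤ _
  rw [LinearIsometryEquiv.norm_map]
  refine ContinuousLinearMap.opNorm_le_bound _ (by positivity) fun b => ?_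
  have h := abs_fderiv_fderiv_newtonKernel_apply_le hx e b
  rw [Real.norm_eq_abs]
  calc |fderiv ℝ (dipoleMoment e) x b| = |fderiv ℝ (fun w => fderiv ℝ newtonKernel w e) x b| := rfl
    _ ≤ ‖e‖ * ‖b‖ / (Real.pi * ‖x‖ ^ 3) := h
    _ = ‖e‖ / (Real.pi * ‖x‖ ^ 3) * ‖b‖ := by ring

/-- `⟪Fₑ(x), x⟫ = −2⟪x,e⟫/(4π|x|³)`, so `Fₑ(x) ≠ 0` wherever `⟪x, e⟫ ≠ 0`. [folklore] -/
theorem quadField_ne_zero (e : ℝ³) {x : ℝ³} (hx : x ≠ 0) (hxe : ⟪x, e⟫ ≠ 0) : quadField e x ≠ 0 := by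
  intro h0
  have h1 : ⟪quadField e x, x⟫ = fderiv ℝ (fun w => fderiv ℝ newtonKernel w e) x x := by
    show ⟪(InnerProductSpace.toDual ℝ ℝ³).symm (fderiv ℝ (dipoleMoment e) x), x⟫ = _
    rw [InnerProductSpace.toDual_symm_apply]
    rfl
  rw [h0, inner_zero_left, fderiv_fderiv_newtonKernel_apply hx, real_inner_self_eq_norm_sq] at h1
  have hx' : 0 < ‖x‖ := norm_pos_iff.2 hx
  have hπ : 0 < Real.pi := Real.pi_pos
  have h2 : ⟪e, x⟫ * ‖x‖ ^ 2 - 3 * ⟪x, e⟫ * ‖x‖ ^ 2 = 0 := by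
    have hden : (4 * Real.pi * ‖x‖ ^ 5) ≠ 0 := by positivity
    have := h1.symm
    rw [div_eq_zero_iff] at this
    exact this.resolve_right hden
  rw [real_inner_comm x e] at h2
  have h3 : ⟪x, e⟫ * ‖x‖ ^ 2 = 0 := by linarith
  rcases mul_eq_zero.1 h3 with h4 | h4
  · exact hxe h4
  · exact pow_ne_zero 2 hx'.ne' h4

/-- THE `l = 1` FLOW `u(t,x) = c (−t) Fₑ(x)` — in similarity variables the stationary profile
`W(y) = c Fₑ(y) = O(|y|⁻³)`, `∇W = O(|y|⁻⁴)` (`u = (−t)^{−1/2} W(x/√−t)` since `Fₑ` is `(−3)`-homogeneous).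
[cite: Serrin1962, the example u = a(t)∇h] -/
def quadFlow (c : ℝ) (e : ℝ³) : ℝ → ℝ³ → ℝ³ := fun t x => (c * (-t)) • quadField e x

/-- Its pressure `p = −a'Φₑ − a²|Fₑ|²/2` with `a(t) = c(−t)`, `a' = −c`. [cite: Serrin1962, the example u = a(t)∇h] -/
def quadPressure (c : ℝ) (e : ℝ³) : ℝ → ℝ³ → ℝ :=
  fun t x => -(-c) * dipoleMoment e x - (c * (-t)) ^ 2 * (2⁻¹ * ‖quadField e x‖ ^ 2)

/-- **The `l = 1` flow is a classical Navier–Stokes solution on the parabolic exterior** (indeed on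
`{t < 0} × (ℝ³ ∖ {0})`). [folklore] -/
theorem quadFlow_isClassical (c : ℝ) (e : ℝ³) {R : ℝ} (hR : 0 ≤ R) :
    IsClassicalNSSolutionOnRegion (parabolicExterior R) 1 0 (quadFlow c e) (quadPressure c e) := by
  rw [isClassicalNSSolutionOnRegion_iff_of_isOpen (isOpen_parabolicExterior R)]
  have hamp : ∀ z : ℝ × ℝ³, ContDiffAt ℝ ((⊤ : ℕ∞) : WithTop ℕ∞) (fun w : ℝ × ℝ³ => c * (-w.1)) z :=
    fun z => contDiffAt_const.mul contDiffAt_fst.neg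
  refine ⟨?_, ?_, ?_, ?_⟩
  · intro z hz
    have hx : z.2 ≠ 0 := snd_ne_zero_of_mem_parabolicExterior hR hz
    exact ((hamp z).smul ((contDiffAt_quadField e hx).comp z contDiffAt_snd)).contDiffWithinAt
  · intro z hz
    have hx : z.2 ≠ 0 := snd_ne_zero_of_mem_parabolicExterior hR hz
    have hF : ContDiffAt ℝ ((⊤ : ℕ∞) : WithTop ℕ∞) (fun w : ℝ × ℝ³ => quadField e w.2) z :=
      (contDiffAt_quadField e hx).comp z contDiffAt_snd
    have hΦ : ContDiffAt ℝ ((⊤ : ℕ∞) : WithTop ℕ∞) (fun w : ℝ × ℝ³ => dipoleMoment e w.2) z :=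
      (contDiffAt_dipoleMoment e hx).comp z contDiffAt_snd
    exact ((contDiffAt_const.mul hΦ).sub (((hamp z).pow 2).mul (contDiffAt_const.mul (hF.norm_sq ℝ)))).contDiffWithinAt
  · intro t x hz
    have hx : x ≠ 0 := snd_ne_zero_of_mem_parabolicExterior hR hz
    obtain ⟨_, hΔ, hconv⟩ := quadField_identities e hx
    have hFd : DifferentiableAt ℝ (quadField e) x := (contDiffAt_quadField e hx (n := 1)).differentiableAt one_ne_zero
    have hD : HasFDerivAt (quadField e) (fderiv ℝ (quadField e) x) x := hFd.hasFDerivAt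
    have h1 : deriv (fun s => quadFlow c e s x) t = (-c) • quadField e x := by
      have ha : HasDerivAt (fun s : ℝ => c * (-s)) (c * (-1)) t := (hasDerivAt_neg t).const_mul c
      have := (ha.smul_const (quadField e x)).deriv
      rw [show c * (-1) = -c by ring] at this
      exact this
    have h2 : convect (quadFlow c e t) (quadFlow c e t) x =
        ((c * (-t)) * (c * (-t))) • gradient (fun y => 2⁻¹ * ‖quadField e y‖ ^ 2) x := by
      rw [convect, show quadFlow c e t = (c * (-t)) • quadField e from rfl, (hD.const_smul (c * (-t))).fderiv,
        FunLike.coe_smul, Pi.smul_apply, Pi.smul_apply, map_smul, smul_smul, ← hconv, convect]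
    have h3 : Δ (quadFlow c e t) x = 0 := by
      show Δ ((c * (-t)) • quadField e) x = 0
      rw [InnerProductSpace.laplacian_smul _ (contDiffAt_quadField e hx), hΔ, smul_zero]
    have hφd : DifferentiableAt ℝ (fun y => 2⁻¹ * ‖quadField e y‖ ^ 2) x := (hFd.norm_sq ℝ).const_mul _
    have hΦd : HasFDerivAt (dipoleMoment e) (fderiv ℝ (dipoleMoment e) x) x :=
      ((contDiffAt_dipoleMoment e hx (n := 1)).differentiableAt one_ne_zero).hasFDerivAt
    have hp : HasFDerivAt (quadPressure c e t)
        ((-(-c)) • fderiv ℝ (dipoleMoment e) x -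
          (c * (-t)) ^ 2 • fderiv ℝ (fun y => 2⁻¹ * ‖quadField e y‖ ^ 2) x) x :=
      (hΦd.const_mul (-(-c))).sub (hφd.hasFDerivAt.const_mul ((c * (-t)) ^ 2))
    have h4 : gradient (quadPressure c e t) x =
        (-(-c)) • quadField e x - (c * (-t)) ^ 2 • gradient (fun y => 2⁻¹ * ‖quadField e y‖ ^ 2) x := by
      show (InnerProductSpace.toDual ℝ ℝ³).symm (fderiv ℝ (quadPressure c e t) x) = _
      rw [hp.fderiv, map_sub, map_smul, map_smul]
      rfl
    rw [h1, h2, h3, h4]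
    simp only [smul_zero, Pi.zero_apply, add_zero, zero_sub, neg_sub, neg_smul, sq, neg_neg]
    abel
  · intro t x hz
    have hx : x ≠ 0 := snd_ne_zero_of_mem_parabolicExterior hR hz
    obtain ⟨hdiv, -, -⟩ := quadField_identities e hx
    have hFd : DifferentiableAt ℝ (quadField e) x := (contDiffAt_quadField e hx (n := 1)).differentiableAt one_ne_zero
    rw [VectorCalculus.divergence, show quadFlow c e t = (c * (-t)) • quadField e from rfl,
      (hFd.hasFDerivAt.const_smul (c * (-t))).fderiv, ContinuousLinearMap.toLinearMap_smul, map_smul,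
      ← VectorCalculus.divergence, hdiv, smul_zero]

/-- Hence a suitable weak solution on `Ω_R`. [folklore] -/
theorem quadFlow_isSuitable (c : ℝ) (e : ℝ³) {R : ℝ} (hR : 0 ≤ R) :
    IsSuitableWeakSolutionOn (parabolicExteriorOpens R) 1 0 (quadFlow c e) (quadPressure c e) :=
  (quadFlow_isClassical c e hR).isSuitableWeakSolutionOn_of_subset one_pos
    (Q := parabolicExteriorOpens R) (fun _ hz => hz)

/-- `c = 0` gives the zero flow. [folklore] -/
theorem quadFlow_zero (e : ℝ³) : quadFlow 0 e = fun _ _ => (0 : ℝ³) := by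
  funext t x
  simp [quadFlow]

/-- `‖u(t,x)‖ ≤ |c| (−t) ‖e‖/(π|x|³)` for `t ≤ 0`, `x ≠ 0`. [folklore] -/
theorem norm_quadFlow_le (c : ℝ) (e : ℝ³) {t : ℝ} (ht : t ≤ 0) {x : ℝ³} (hx : x ≠ 0) :
    ‖quadFlow c e t x‖ ≤ |c| * (-t) * (‖e‖ / (Real.pi * ‖x‖ ^ 3)) := by
  rw [quadFlow, norm_smul, Real.norm_eq_abs, abs_mul, abs_of_nonneg (by linarith : 0 ≤ -t)]
  exact mul_le_mul_of_nonneg_left (norm_quadField_le e hx) (mul_nonneg (abs_nonneg c) (by linarith))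

/-- **Type I on the parabolic exterior** for the `l = 1` flow, `‖e‖ = 1`, `R ≥ 1`: the Type-I constant is
`|c|` (`(−t)(|x|+√−t) ≤ 2|x|³` there, and `2/π ≤ 1`). [folklore] -/
theorem quadFlow_typeI (c : ℝ) {e : ℝ³} (he : ‖e‖ = 1) {R : ℝ} (hR : 1 ≤ R) :
    ∀ z ∈ parabolicExterior R, ‖quadFlow c e z.1 z.2‖ ≤ |c| / (‖z.2‖ + Real.sqrt (-z.1)) := by
  rintro ⟨t, x⟩ hz
  have ht : t < 0 := hz.1
  have hRx : R * Real.sqrt (-t) < ‖x‖ := hz.2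
  have hx : x ≠ 0 := snd_ne_zero_of_mem_parabolicExterior (by linarith) hz
  set s := Real.sqrt (-t) with hs
  set n := ‖x‖ with hn
  have hs0 : 0 < s := Real.sqrt_pos.2 (by linarith)
  have hn0 : 0 < n := norm_pos_iff.2 hx
  have hsn : s ≤ n := by nlinarith
  have hss : s ^ 2 = -t := Real.sq_sqrt (by linarith)
  have hπ : (3 : ℝ) < Real.pi := Real.pi_gt_three
  show ‖quadFlow c e t x‖ ≤ |c| / (n + s)
  refine (norm_quadFlow_le c e ht.le hx).trans ?_
  rw [he, ← hn]
  have key : (-t) * (1 / (Real.pi * n ^ 3)) ≤ 1 / (n + s) := by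
    rw [← hss, mul_one_div, div_le_div_iff₀ (by positivity) (by positivity), one_mul]
    have h1 : s ^ 2 * (n + s) ≤ n ^ 2 * (n + n) := by gcongr
    have h2 : n ^ 2 * (n + n) ≤ Real.pi * n ^ 3 := by
      have : 0 ≤ (Real.pi - 2) * n ^ 3 := mul_nonneg (by linarith) (pow_nonneg hn0.le 3)
      nlinarith
    exact h1.trans h2
  calc |c| * (-t) * (1 / (Real.pi * n ^ 3)) = |c| * ((-t) * (1 / (Real.pi * n ^ 3))) := by ring
    _ ≤ |c| * (1 / (n + s)) := by gcongr
    _ = |c| / (n + s) := by ring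

/-- Same (zero) scar as the zero flow: `‖u‖ ≤ |c| δ ‖e‖/(πρ³)` on `(−δ,0) × K`, `K ⊆ {‖x‖ ≥ ρ}`. [folklore] -/
theorem tendsto_eLpNorm_quadFlow (c : ℝ) (e : ℝ³) : ∀ K : Set ℝ³, IsCompact K → (0 : ℝ³) ∉ K →
    Tendsto (fun δ : ℝ => eLpNorm (uncurry (quadFlow 0 e) - uncurry (quadFlow c e)) ⊤
      (volume.restrict (Ioo (-δ) 0 ×ˢ K))) (𝓝[>] 0) (𝓝 0) := by
  intro K hK h0
  obtain ⟨ρ, hρ, hball⟩ := Metric.isOpen_iff.1 hK.isClosed.isOpen_compl 0 (mem_compl h0)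
  have hmeas : ∀ δ : ℝ, MeasurableSet (Ioo (-δ) (0 : ℝ) ×ˢ K) := fun δ =>
    measurableSet_Ioo.prod hK.isClosed.measurableSet
  have hbound : ∀ δ : ℝ, 0 < δ → eLpNorm (uncurry (quadFlow 0 e) - uncurry (quadFlow c e)) ⊤
      (volume.restrict (Ioo (-δ) 0 ×ˢ K)) ≤ ENNReal.ofReal (|c| * δ * (‖e‖ / (Real.pi * ρ ^ 3))) := by
    intro δ hδ
    rw [eLpNorm_exponent_top]
    refine eLpNormEssSup_le_of_ae_bound ?_
    filter_upwards [ae_restrict_mem (hmeas δ)] with z hz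
    obtain ⟨⟨hz1, hz2⟩, hzK⟩ := hz
    have hnorm : ρ ≤ ‖z.2‖ := by
      by_contra hlt
      exact hball (mem_ball_zero_iff.2 (not_le.1 hlt)) hzK
    have hx : z.2 ≠ 0 := norm_pos_iff.1 (hρ.trans_le hnorm)
    have : (uncurry (quadFlow 0 e) - uncurry (quadFlow c e)) z = -(quadFlow c e z.1 z.2) := by
      simp [uncurry, quadFlow_zero]
    rw [this, norm_neg]
    refine (norm_quadFlow_le c e hz2.le hx).trans ?_
    have hπ : 0 < Real.pi := Real.pi_pos
    gcongr
    · linarith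
  have hup : Tendsto (fun δ : ℝ => ENNReal.ofReal (|c| * δ * (‖e‖ / (Real.pi * ρ ^ 3)))) (𝓝[>] 0) (𝓝 0) := by
    have h0 : Tendsto (fun δ : ℝ => |c| * δ * (‖e‖ / (Real.pi * ρ ^ 3))) (𝓝 0) (𝓝 0) := by
      have := ((tendsto_id (x := 𝓝 (0 : ℝ))).const_mul |c|).mul_const (‖e‖ / (Real.pi * ρ ^ 3))
      simpa using this
    simpa using (ENNReal.tendsto_ofReal h0).mono_left nhdsWithin_le_nhds
  refine tendsto_of_tendsto_of_tendsto_of_le_of_le' tendsto_const_nhds hup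
    (Eventually.of_forall fun δ => zero_le) ?_
  filter_upwards [self_mem_nhdsWithin] with δ hδ
  exact hbound δ hδ

/-- **Backward NON-uniqueness from the scar on the parabolic exterior inside the decay class `O(|x|⁻³)`**:
for every `R ≥ 1` and every `C > 0` there is a unit vector `e` such that `u₁ = 0` and the `l = 1` flow
`u₂ = C(−t)∇(∂ₑΓ)(x)` are suitable weak solutions of Navier–Stokes on `Ω_R`, `u₂` obeys the Type-I bound with
constant `C` and the decay bound `‖u₂(t,x)‖ ≤ C(−t)/(π|x|³)` (similarity profile `|W| ≤ C/(π|y|³)`), both have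
the same final-time trace off the origin (zero), and they are NOT a.e. equal on `Ω_R`. [folklore] -/
theorem exists_sameScar_typeI_cubicDecay_not_aeEq_parabolicExterior {R C : ℝ} (hR : 1 ≤ R) (hC : 0 < C) :
    ∃ e : ℝ³, ‖e‖ = 1 ∧
      IsSuitableWeakSolutionOn (parabolicExteriorOpens R) 1 0 (quadFlow 0 e) (quadPressure 0 e) ∧
      IsSuitableWeakSolutionOn (parabolicExteriorOpens R) 1 0 (quadFlow C e) (quadPressure C e) ∧
      (∀ z ∈ parabolicExterior R, ‖quadFlow C e z.1 z.2‖ ≤ C / (‖z.2‖ + Real.sqrt (-z.1))) ∧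
      (∀ z ∈ parabolicExterior R, ‖quadFlow C e z.1 z.2‖ ≤ C / (Real.pi * ‖z.2‖ ^ 3) * (-z.1)) ∧
      (∀ K : Set ℝ³, IsCompact K → (0 : ℝ³) ∉ K →
        Tendsto (fun δ : ℝ => eLpNorm (uncurry (quadFlow 0 e) - uncurry (quadFlow C e)) ⊤
          (volume.restrict (Ioo (-δ) 0 ×ˢ K))) (𝓝[>] 0) (𝓝 0)) ∧
      ¬ uncurry (quadFlow 0 e) =ᵐ[volume.restrict (parabolicExterior R)] uncurry (quadFlow C e) := by
  obtain ⟨e, he⟩ := exists_norm_eq ℝ³ zero_le_one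
  have hR0 : 0 ≤ R := by linarith
  refine ⟨e, he, quadFlow_isSuitable 0 e hR0, quadFlow_isSuitable C e hR0, ?_, ?_, tendsto_eLpNorm_quadFlow C e, ?_⟩
  · intro z hz
    simpa [abs_of_pos hC] using quadFlow_typeI C he hR z hz
  · intro z hz
    have hx : z.2 ≠ 0 := snd_ne_zero_of_mem_parabolicExterior hR0 hz
    have := norm_quadFlow_le C e (le_of_lt hz.1) hx
    rw [he, abs_of_pos hC] at this
    refine this.trans (le_of_eq ?_)
    ring
  · -- they differ on the open set `Ω_R ∩ {⟪x, e⟫ ≠ 0}`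
    set U : Set (ℝ × ℝ³) := parabolicExterior R ∩ {z | ⟪z.2, e⟫ ≠ 0} with hU
    have hUo : IsOpen U :=
      (isOpen_parabolicExterior R).inter (isOpen_ne_fun (continuous_snd.inner continuous_const) continuous_const)
    have hUne : U.Nonempty := by
      refine ⟨((-1 : ℝ), (R + 1) • e), ⟨by norm_num, ?_⟩, ?_⟩
      · show R * Real.sqrt (-(-1 : ℝ)) < ‖(R + 1) • e‖
        rw [neg_neg, Real.sqrt_one, mul_one, norm_smul, he, mul_one, Real.norm_of_nonneg (by linarith)]
        linarith
      · show ⟪(R + 1) • e, e⟫ ≠ 0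
        rw [real_inner_smul_left, real_inner_self_eq_norm_sq, he]
        norm_num
        linarith
    refine not_aeEq_restrict_of_ne_on_open hUo hUne inter_subset_left fun z hz => ?_
    have hx : z.2 ≠ 0 := snd_ne_zero_of_mem_parabolicExterior hR0 hz.1
    have hF := quadField_ne_zero e hx hz.2
    have hz1 : z.1 < 0 := hz.1.1
    have ha : C * (-z.1) ≠ 0 := mul_ne_zero hC.ne' (by linarith)
    simp only [uncurry, quadFlow_zero, ne_eq]
    intro h'
    exact (smul_ne_zero ha hF) (by simpa [quadFlow] using h'.symm)

end Literature.Analysis.FluidPDE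

end
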